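import Summits.CriticalPhenomena.PercolationContinuityZ3.Theorems.PercNearOneGluingNoHeavyRsw3NarrowHardCrossing
import HarnessLib

/-!
# RSW3 lane (P2, gen 7): hard-direction crossings at `p_c(ℤ³)` — explicit floors `c_a / n^{4a-2}` for the `a : 1` box,
# every side `n` (the narrow chain of `…Rsw3NarrowHardCrossing` evaluated at `p_c`)

builds on p205010 (kernel theorem, internal audit signed; external expert review pending)

Cell `prim-rsw3`, prover seat `prim-rsw3-p2` (gen 7), memo `run/shared/lean/prim/rsw3/P2-RSWLITE.md` §13.
Support file (`--supports stmt-CriticalPhenomena-4575`); no definitions, no named facts, no sorries.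

* `exists_le_real_narrowBoxCrossing_criticalProbI` (`d ≥ 2`): the narrow tube `T_{k,r}(L)` (width `2L`, length
  `(2k+2)L + r`) is crossed lengthwise at `p_c(ℤ^d)` with probability `≥ c^{k+1} p_c^r / L^{(2k+1)(d-1)}` for all
  `L ≥ 1`, `k, r` — `Rsw3.le_real_narrowBoxCrossing` with `π_{p_c}(L)² ≥ c₁/L^{d-1}`
  (`exists_oneArmProb_criticalProbI_sq_lower`) and `|∂Λ(L)| ≤ 2d 3^{d-1} L^{d-1}`;
* `exists_le_real_boxCross_hardShape_sharp` (`d = 3`, lane vocabulary): for every `a ≥ 1` there is `c_a > 0` with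
  `P_{p_c(ℤ³)}(boxCross (hardShape a n) 0) ≥ c_a / n^{4a-2}` for EVERY `n ≥ 1` (`2 : 1` box `n^{-6}`, `3 : 1` box
  `n^{-10}`; tree before: `n^{-(16a+2)}`, `Rsw3.exists_le_real_boxCross_hardShape`, and `M^{-(8a-6)}` for the
  width-`4M` tubes of `Rsw3.exists_le_real_longBoxCrossing_criticalProbI`);
* `exists_le_real_boxCross_cubeShape`: the cube of EVERY side, `≥ c / n²` (tree: even sides, `…_cubeShape_even`).

The exponent `2(d-1)` per unit of aspect ratio is the price `|∂Λ(L)|²` of one point relay per advance of one width —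
what point gluing gives; the uniform statements `HardCrossingLowerBound a` / `CrossingLowerBound cubeShape 0` remain
the open lower half of a 3D box-crossing property (census: `H_a(n) ≈ 4.4 e^{-2.74 a}`, scale-free; non-rigorous).
RATES only.

References: G. Grimmett, *Percolation* (1999), Thm. (6.44), (6.61), Thm. (2.4); G. Kozma, A. Nachmias, J. Amer.
Math. Soc. 24 (2011), §3; H. Kesten, *Percolation Theory for Mathematicians* (1982), §3.3. [folklore]
-/

noncomputable section

namespace Summit.CriticalPhenomena.PercolationContinuityZ3.Theorems

open MeasureTheory ProbabilityTheory Filter Topology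
open Literature.Probability.Percolation Literature.Probability.LatticeModels
open Literature.Barriers.CriticalPhenomena

namespace Rsw3

open SurfaceTension Crossing

variable {d : ℕ}

/-! ## At `p_c`: explicit polynomial floors -/

/-- **AT `p_c`: the narrow tube `T_{k,r}(L)` (width `2L`, length `(2k+2)L + r`) is crossed lengthwise with
probability at least `c^{k+1} p_c^r / L^{(2k+1)(d-1)}`** for all `L ≥ 1`, `k, r ∈ ℕ` (`d ≥ 2`, `c = c(d) > 0`):
`le_real_narrowBoxCrossing` with `π_{p_c}(L)² ≥ c₁/L^{d-1}` (`exists_oneArmProb_criticalProbI_sq_lower`) and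
`|∂Λ(L)| ≤ 2d 3^{d-1} L^{d-1}` (`card_sphere_succ_le'`).  `r = 0`: aspect ratio exactly `k + 1`; `d = 3`:
`≥ c^{k+1}/L^{4k+2}` (the `2 : 1` tube: `L^{-6}`; the tree's `Rsw3.exists_le_real_longBoxCrossing_criticalProbI`, whose
tube of aspect `2` has width `4M`, gives `M^{-10}`). [folklore] -/
theorem exists_le_real_narrowBoxCrossing_criticalProbI (hd : 2 ≤ d) :
    ∃ c : ℝ, 0 < c ∧ ∀ (L : ℕ), 1 ≤ L → ∀ (j : Fin d) (k r : ℕ),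
      c ^ (k + 1) * ((criticalProbI d : unitInterval) : ℝ) ^ r / (L : ℝ) ^ ((2 * k + 1) * (d - 1)) ≤
        (bondPercolation (zdGraph d) (criticalProbI d)).real
          (linked {y : Site d | (-(L : ℤ) ≤ y j ∧ y j ≤ (2 * k + 1) * L + r) ∧
              ∀ i, i ≠ j → -(L : ℤ) ≤ y i ∧ y i ≤ L}
            (cubeFace L j (-1))
            ((zdShiftIso (Pi.single j ((r : ℤ) + 2 * k * L) : Site d)) '' cubeFace L j 1)) := by
  obtain ⟨c₁, hc₁, hπ⟩ := exists_oneArmProb_criticalProbI_sq_lower hd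
  have hd1 : 1 ≤ d := by omega
  set a : ℝ := c₁ / (2 * d) ^ 2 with ha
  set b : ℝ := (1 / (2 * d * (2 * d * 3 ^ (d - 1)))) ^ 2 with hb
  have ha0 : 0 < a := by positivity
  have hb0 : 0 < b := by positivity
  refine ⟨min a b, lt_min ha0 hb0, fun L hL j k r => ?_⟩
  set pc : unitInterval := criticalProbI d with hpc
  have hL0 : (0 : ℝ) < L := by exact_mod_cast hL
  -- end factor: `a / L^{d-1} ≤ (π(L)/(2d))²`
  have hend : a / (L : ℝ) ^ (d - 1) ≤ (oneArmProb d pc L / (2 * d)) ^ 2 := by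
    have h := hπ L hL
    rw [div_pow, ha]
    calc c₁ / (2 * d) ^ 2 / (L : ℝ) ^ (d - 1) = (c₁ / (L : ℝ) ^ (d - 1)) / (2 * d) ^ 2 := by
          rw [div_div, div_div, mul_comm]
      _ ≤ oneArmProb d pc L ^ 2 / (2 * (d : ℝ)) ^ 2 := div_le_div_of_nonneg_right h (by positivity)
  -- step factor: `b / L^{2(d-1)} ≤ q_L²`
  have hstep : b / ((L : ℝ) ^ (d - 1)) ^ 2 ≤ cubeStepProb d L ^ 2 := by
    obtain ⟨m, rfl⟩ : ∃ m, L = m + 1 := ⟨L - 1, by omega⟩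
    have hcard : ((sphere d (m + 1)).card : ℝ) ≤ 2 * d * 3 ^ (d - 1) * (((m + 1 : ℕ) : ℝ)) ^ (d - 1) := by
      have h := card_sphere_succ_le' (d := d) hd1 m
      push_cast at h ⊢
      exact h
    have hcard0 : (0 : ℝ) < (sphere d (m + 1)).card := by
      exact_mod_cast Finset.card_pos.2 (sphere_nonempty hd1 (m + 1))
    have hq : 1 / (2 * d * (2 * d * 3 ^ (d - 1))) / (((m + 1 : ℕ) : ℝ)) ^ (d - 1) ≤
        cubeStepProb d (m + 1) := by
      rw [cubeStepProb, div_div, one_div_le_one_div (by positivity) (by positivity)]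
      calc 2 * (d : ℝ) * (sphere d (m + 1)).card
          ≤ 2 * d * (2 * d * 3 ^ (d - 1) * (((m + 1 : ℕ) : ℝ)) ^ (d - 1)) := by gcongr
        _ = 2 * d * (2 * d * 3 ^ (d - 1)) * (((m + 1 : ℕ) : ℝ)) ^ (d - 1) := by ring
    have hq0 : 0 ≤ 1 / (2 * d * (2 * d * 3 ^ (d - 1))) / (((m + 1 : ℕ) : ℝ)) ^ (d - 1) := by positivity
    calc b / ((((m + 1 : ℕ) : ℝ)) ^ (d - 1)) ^ 2
        = (1 / (2 * d * (2 * d * 3 ^ (d - 1))) / (((m + 1 : ℕ) : ℝ)) ^ (d - 1)) ^ 2 := by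
          rw [hb, ← div_pow]
      _ ≤ cubeStepProb d (m + 1) ^ 2 := pow_le_pow_left₀ hq0 hq 2
  -- combine
  have hmain := le_real_narrowBoxCrossing hd pc le_rfl L j k r
  refine le_trans ?_ hmain
  have hmin0 : 0 ≤ min a b := (lt_min ha0 hb0).le
  have hpc0 : (0 : ℝ) ≤ (pc : ℝ) ^ r := pow_nonneg pc.2.1 r
  have hpow : (L : ℝ) ^ ((2 * k + 1) * (d - 1)) = (L : ℝ) ^ (d - 1) * (((L : ℝ) ^ (d - 1)) ^ 2) ^ k := by
    rw [← pow_mul, ← pow_mul, ← pow_add]; congr 1; ring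
  rw [hpow, pow_succ, show cubeStepProb d L ^ (2 * k) = (cubeStepProb d L ^ 2) ^ k by rw [pow_mul]]
  calc (min a b) ^ k * min a b * (pc : ℝ) ^ r / ((L : ℝ) ^ (d - 1) * (((L : ℝ) ^ (d - 1)) ^ 2) ^ k)
      = (min a b / (L : ℝ) ^ (d - 1)) * (pc : ℝ) ^ r * (min a b / ((L : ℝ) ^ (d - 1)) ^ 2) ^ k := by
        rw [div_pow]; field_simp
    _ ≤ (a / (L : ℝ) ^ (d - 1)) * (pc : ℝ) ^ r * (b / ((L : ℝ) ^ (d - 1)) ^ 2) ^ k := by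
        gcongr
        · exact min_le_left a b
        · exact min_le_right a b
    _ ≤ (oneArmProb d pc L / (2 * d)) ^ 2 * (pc : ℝ) ^ r * (cubeStepProb d L ^ 2) ^ k := by
        gcongr

/-! ## The lane's vocabulary (`d = 3`): `hardShape a n`, every side `n` -/

/-- **Polynomial floor for every hard shape, sharp form.** For `a ≥ 1` there is `c = c(a) > 0` with
`c / n^{4a-2} ≤ P_{p_c(ℤ³)}(boxCross (hardShape a n) 0)` for ALL `n ≥ 1`: `n = 1` — the segment of `a` open edges
(`pow_le_real_boxCross`); `n ≥ 2` — with `L = ⌊n/2⌋`, `n = 2L + r₀` (`r₀ ∈ {0,1}`), the narrow tube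
`T_{a-1, a r₀}(L)` (width `2L ≤ n`, length `2aL + a r₀ = a n` EXACTLY) of
`exists_le_real_narrowBoxCrossing_criticalProbI` (`≥ c₀^a p_c^{a r₀}/L^{4a-2}`), transferred to the block
`{0..hardShape a n}` by `real_linked_le_real_boxCross`.  Numbers: cube `a = 1`: `n^{-2}` (every side — the tree had
`c/L²` for even sides only, `exists_le_real_boxCross_cubeShape_even`, and `n^{-18}` in general); `2 : 1` box: `n^{-6}`
(tree: `n^{-34}`, `exists_le_real_boxCross_hardShape`; `M^{-10}` for the width-`4M` tube of p208466); `a : 1` box: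
`n^{-(4a-2)}` (tree: `n^{-(16a+2)}`).  RATES: `HardCrossingLowerBound a` stays open. [folklore] -/
theorem exists_le_real_boxCross_hardShape_sharp {a : ℕ} (ha : 1 ≤ a) :
    ∃ c : ℝ, 0 < c ∧ ∀ n : ℕ, 1 ≤ n →
      c / (n : ℝ) ^ (4 * a - 2) ≤
        (bondPercolation (zdGraph 3) (criticalProbI 3)).real (boxCross (hardShape a n) 0) := by
  classical
  set pc : unitInterval := criticalProbI 3 with hpc
  have hpc0 : (0 : ℝ) < pc := by
    rw [hpc, coe_criticalProbI]; exact criticalProb_zd_pos 3 (by norm_num)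
  obtain ⟨c₀, hc₀, hnar⟩ := exists_le_real_narrowBoxCrossing_criticalProbI (d := 3) (by norm_num)
  refine ⟨min ((pc : ℝ) ^ a) (c₀ ^ a * (pc : ℝ) ^ a), lt_min (by positivity) (by positivity), fun n hn => ?_⟩
  have hshape : ∀ j : Fin 3, 0 ≤ hardShape a n j := by
    intro j
    fin_cases j <;> simp [hardShape]
    positivity
  have hdivle : min ((pc : ℝ) ^ a) (c₀ ^ a * (pc : ℝ) ^ a) / (n : ℝ) ^ (4 * a - 2) ≤
      min ((pc : ℝ) ^ a) (c₀ ^ a * (pc : ℝ) ^ a) :=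
    div_le_self (by positivity) (one_le_pow₀ (by exact_mod_cast hn))
  by_cases h1 : n = 1
  · -- a straight open segment of `a` edges
    subst h1
    have hseg := pow_le_real_boxCross pc hshape 0
    have h0 : (hardShape a 1 0).toNat = a := by simp [hardShape]
    rw [h0] at hseg
    exact (hdivle.trans (min_le_left _ _)).trans hseg
  · -- the narrow tube of half-width `L = ⌊n/2⌋`, `n = 2L + r₀`
    set L : ℕ := n / 2 with hL
    set r₀ : ℕ := n % 2 with hr₀
    have hL1 : 1 ≤ L := by omega
    have hnL : n = 2 * L + r₀ := by omega
    have hr₀1 : r₀ ≤ 1 := by omega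
    have hnZ : (n : ℤ) = 2 * L + r₀ := by exact_mod_cast hnL
    have hL0 : (0 : ℝ) < L := by exact_mod_cast hL1
    have hLn : (L : ℝ) ≤ n := by exact_mod_cast (show L ≤ n by omega)
    have hmain := hnar L hL1 0 (a - 1) (a * r₀)
    have hexp : (2 * (a - 1) + 1) * (3 - 1) = 4 * a - 2 := by omega
    have hk1 : a - 1 + 1 = a := by omega
    rw [hexp, hk1] at hmain
    -- `c/n^{4a-2} ≤ c₀^a p_c^{a r₀}/L^{4a-2}`
    have har : a * r₀ ≤ a := by
      calc a * r₀ ≤ a * 1 := Nat.mul_le_mul_left a hr₀1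
        _ = a := mul_one a
    have hstep1 : min ((pc : ℝ) ^ a) (c₀ ^ a * (pc : ℝ) ^ a) / (n : ℝ) ^ (4 * a - 2) ≤
        c₀ ^ a * (pc : ℝ) ^ (a * r₀) / (L : ℝ) ^ (4 * a - 2) := by
      calc min ((pc : ℝ) ^ a) (c₀ ^ a * (pc : ℝ) ^ a) / (n : ℝ) ^ (4 * a - 2)
          ≤ c₀ ^ a * (pc : ℝ) ^ a / (n : ℝ) ^ (4 * a - 2) :=
            div_le_div_of_nonneg_right (min_le_right _ _) (by positivity)
        _ ≤ c₀ ^ a * (pc : ℝ) ^ (a * r₀) / (n : ℝ) ^ (4 * a - 2) := by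
            apply div_le_div_of_nonneg_right _ (by positivity)
            exact mul_le_mul_of_nonneg_left (pow_le_pow_of_le_one pc.2.1 pc.2.2 har) (by positivity)
        _ ≤ c₀ ^ a * (pc : ℝ) ^ (a * r₀) / (L : ℝ) ^ (4 * a - 2) := by
            apply div_le_div_of_nonneg_left (by positivity) (pow_pos hL0 _)
            exact pow_le_pow_left₀ hL0.le hLn _
    refine hstep1.trans (hmain.trans ?_)
    -- the length of the tube is `a n` exactly
    have ha1 : ((a - 1 : ℕ) : ℤ) = (a : ℤ) - 1 := by omega
    have hlen : (2 * ((a - 1 : ℕ) : ℤ) + 1) * (L : ℤ) + ((a * r₀ : ℕ) : ℤ) = -(L : ℤ) + (a : ℤ) * n := by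
      rw [ha1]; push_cast; linear_combination (-(a : ℤ)) * hnZ
    have hlen' : (L : ℤ) + ((a : ℤ) * (r₀ : ℤ) + 2 * ((a - 1 : ℕ) : ℤ) * L) = -(L : ℤ) + (a : ℤ) * n := by
      rw [← hlen]; push_cast; ring
    -- transfer the tube crossing to the block `{0..hardShape a n}`
    refine real_linked_le_real_boxCross (criticalProbI 3)
      (R := {y : Site 3 | (-(L : ℤ) ≤ y 0 ∧ y 0 ≤ (2 * ((a - 1 : ℕ) : ℤ) + 1) * L + ((a * r₀ : ℕ) : ℤ)) ∧
        ∀ i, i ≠ 0 → -(L : ℤ) ≤ y i ∧ y i ≤ L})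
      (A := cubeFace L 0 (-1))
      (B := (zdShiftIso (Pi.single 0 (((a * r₀ : ℕ) : ℤ) + 2 * ((a - 1 : ℕ) : ℤ) * L) : Site 3)) ''
        cubeFace L 0 1)
      (v := ![-(L : ℤ), -L, -L]) (M := ![(a : ℤ) * n, 2 * L, 2 * L]) (L := hardShape a n) 0
      ?_ ?_ ?_ ?_ ?_ ?_ ?_
    · intro y hy j
      obtain ⟨hy0, hyi⟩ := hy
      fin_cases j
      · simp; constructor <;> linarith [hy0.1, hy0.2, hlen]
      · have := hyi 1 (by decide); simp; constructor <;> linarith [this.1, this.2]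
      · have := hyi 2 (by decide); simp; constructor <;> linarith [this.1, this.2]
    · intro x hx
      simp only [cubeFace, Set.mem_setOf_eq, Units.val_neg, Units.val_one, neg_mul, one_mul] at hx
      obtain ⟨hxbox, hx0⟩ := hx
      rw [mem_box] at hxbox
      refine ⟨?_, fun i hi => ?_⟩
      · have := hxbox 0
        have h0 : (0 : ℤ) ≤ (2 * ((a - 1 : ℕ) : ℤ) + 1) * L + ((a * r₀ : ℕ) : ℤ) := by positivity
        constructor <;> linarith [this.1]
      · exact hxbox i
    · intro x hx
      simp only [cubeFace, Set.mem_setOf_eq, Units.val_neg, Units.val_one, neg_mul, one_mul] at hx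
      simp; linarith [hx.2]
    · rintro y ⟨x, hx, rfl⟩
      simp only [cubeFace, Set.mem_setOf_eq, Units.val_one, one_mul] at hx
      simp [zdShiftIso_apply, hx.2]
      linarith [hlen']
    · exact hshape 0
    · simp [hardShape]
    · intro j hj
      fin_cases j
      · exact absurd rfl hj
      · simp [hardShape]; omega
      · simp [hardShape]; omega

/-- **The critical cube of EVERY side, in the lane's vocabulary**: there is `c > 0` with
`c / n² ≤ P_{p_c(ℤ³)}(boxCross (cubeShape n) 0)` for all `n ≥ 1` (`hardShape 1 = cubeShape`; the tree's
`exists_le_real_boxCross_cubeShape_even` covers even sides).  A RATE: `CrossingLowerBound cubeShape 0` stays open.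
[folklore] -/
theorem exists_le_real_boxCross_cubeShape :
    ∃ c : ℝ, 0 < c ∧ ∀ n : ℕ, 1 ≤ n →
      c / (n : ℝ) ^ 2 ≤ (bondPercolation (zdGraph 3) (criticalProbI 3)).real (boxCross (cubeShape n) 0) := by
  obtain ⟨c, hc, h⟩ := exists_le_real_boxCross_hardShape_sharp (a := 1) le_rfl
  refine ⟨c, hc, fun n hn => ?_⟩
  have hs : hardShape 1 n = cubeShape n := by
    ext j; fin_cases j <;> simp [hardShape, cubeShape]
  have h1 := h n hn
  rw [hs] at h1
  simpa using h1

/-- **Geometric constant.** The floor of `exists_le_real_boxCross_hardShape_sharp` with a constant GEOMETRIC in the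
aspect ratio: there is `c > 0` with `c^a / n^{4a-2} ≤ P_{p_c(ℤ³)}(boxCross (hardShape a n) 0)` for all `a ≥ 1`, `n ≥ 1`
(same proof, `c = min p_c (c₀ p_c)`); equivalently `H_a(n) ≥ n² (c n^{-4})^a` — the hard-crossing decay rate per unit
aspect at `p_c` is at most `4 log n + log(1/c)`, uniformly in `a` (used by `…Rsw3HardCrossingRate`). [folklore] -/
theorem exists_le_real_boxCross_hardShape_geometric :
    ∃ c : ℝ, 0 < c ∧ ∀ a n : ℕ, 1 ≤ a → 1 ≤ n →
      c ^ a / (n : ℝ) ^ (4 * a - 2) ≤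
        (bondPercolation (zdGraph 3) (criticalProbI 3)).real (boxCross (hardShape a n) 0) := by
  classical
  set pc : unitInterval := criticalProbI 3 with hpc
  have hpc0 : (0 : ℝ) < pc := by
    rw [hpc, coe_criticalProbI]; exact criticalProb_zd_pos 3 (by norm_num)
  obtain ⟨c₀, hc₀, hnar⟩ := exists_le_real_narrowBoxCrossing_criticalProbI (d := 3) (by norm_num)
  refine ⟨min (pc : ℝ) (c₀ * pc), lt_min hpc0 (by positivity), fun a n ha hn => ?_⟩
  set c : ℝ := min (pc : ℝ) (c₀ * pc) with hc
  have hc0 : 0 < c := lt_min hpc0 (by positivity)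
  have hcpc : c ^ a ≤ (pc : ℝ) ^ a := pow_le_pow_left₀ hc0.le (min_le_left _ _) a
  have hcc₀ : c ^ a ≤ c₀ ^ a * (pc : ℝ) ^ a := by
    rw [← mul_pow]; exact pow_le_pow_left₀ hc0.le (min_le_right _ _) a
  have hshape : ∀ j : Fin 3, 0 ≤ hardShape a n j := by
    intro j
    fin_cases j <;> simp [hardShape]
    positivity
  have hdivle : c ^ a / (n : ℝ) ^ (4 * a - 2) ≤ c ^ a :=
    div_le_self (by positivity) (one_le_pow₀ (by exact_mod_cast hn))
  by_cases h1 : n = 1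
  · subst h1
    have hseg := pow_le_real_boxCross pc hshape 0
    have h0 : (hardShape a 1 0).toNat = a := by simp [hardShape]
    rw [h0] at hseg
    exact (hdivle.trans hcpc).trans hseg
  · set L : ℕ := n / 2 with hL
    set r₀ : ℕ := n % 2 with hr₀
    have hL1 : 1 ≤ L := by omega
    have hnL : n = 2 * L + r₀ := by omega
    have hr₀1 : r₀ ≤ 1 := by omega
    have hnZ : (n : ℤ) = 2 * L + r₀ := by exact_mod_cast hnL
    have hL0 : (0 : ℝ) < L := by exact_mod_cast hL1
    have hLn : (L : ℝ) ≤ n := by exact_mod_cast (show L ≤ n by omega)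
    have hmain := hnar L hL1 0 (a - 1) (a * r₀)
    have hexp : (2 * (a - 1) + 1) * (3 - 1) = 4 * a - 2 := by omega
    have hk1 : a - 1 + 1 = a := by omega
    rw [hexp, hk1] at hmain
    have har : a * r₀ ≤ a := by
      calc a * r₀ ≤ a * 1 := Nat.mul_le_mul_left a hr₀1
        _ = a := mul_one a
    have hstep1 : c ^ a / (n : ℝ) ^ (4 * a - 2) ≤ c₀ ^ a * (pc : ℝ) ^ (a * r₀) / (L : ℝ) ^ (4 * a - 2) := by
      calc c ^ a / (n : ℝ) ^ (4 * a - 2)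
          ≤ c₀ ^ a * (pc : ℝ) ^ a / (n : ℝ) ^ (4 * a - 2) := div_le_div_of_nonneg_right hcc₀ (by positivity)
        _ ≤ c₀ ^ a * (pc : ℝ) ^ (a * r₀) / (n : ℝ) ^ (4 * a - 2) := by
            apply div_le_div_of_nonneg_right _ (by positivity)
            exact mul_le_mul_of_nonneg_left (pow_le_pow_of_le_one pc.2.1 pc.2.2 har) (by positivity)
        _ ≤ c₀ ^ a * (pc : ℝ) ^ (a * r₀) / (L : ℝ) ^ (4 * a - 2) := by
            apply div_le_div_of_nonneg_left (by positivity) (pow_pos hL0 _)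
            exact pow_le_pow_left₀ hL0.le hLn _
    refine hstep1.trans (hmain.trans ?_)
    have ha1 : ((a - 1 : ℕ) : ℤ) = (a : ℤ) - 1 := by omega
    have hlen : (2 * ((a - 1 : ℕ) : ℤ) + 1) * (L : ℤ) + ((a * r₀ : ℕ) : ℤ) = -(L : ℤ) + (a : ℤ) * n := by
      rw [ha1]; push_cast; linear_combination (-(a : ℤ)) * hnZ
    have hlen' : (L : ℤ) + ((a : ℤ) * (r₀ : ℤ) + 2 * ((a - 1 : ℕ) : ℤ) * L) = -(L : ℤ) + (a : ℤ) * n := by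
      rw [← hlen]; push_cast; ring
    refine real_linked_le_real_boxCross (criticalProbI 3)
      (R := {y : Site 3 | (-(L : ℤ) ≤ y 0 ∧ y 0 ≤ (2 * ((a - 1 : ℕ) : ℤ) + 1) * L + ((a * r₀ : ℕ) : ℤ)) ∧
        ∀ i, i ≠ 0 → -(L : ℤ) ≤ y i ∧ y i ≤ L})
      (A := cubeFace L 0 (-1))
      (B := (zdShiftIso (Pi.single 0 (((a * r₀ : ℕ) : ℤ) + 2 * ((a - 1 : ℕ) : ℤ) * L) : Site 3)) ''
        cubeFace L 0 1)
      (v := ![-(L : ℤ), -L, -L]) (M := ![(a : ℤ) * n, 2 * L, 2 * L]) (L := hardShape a n) 0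
      ?_ ?_ ?_ ?_ ?_ ?_ ?_
    · intro y hy j
      obtain ⟨hy0, hyi⟩ := hy
      fin_cases j
      · simp; constructor <;> linarith [hy0.1, hy0.2, hlen]
      · have := hyi 1 (by decide); simp; constructor <;> linarith [this.1, this.2]
      · have := hyi 2 (by decide); simp; constructor <;> linarith [this.1, this.2]
    · intro x hx
      simp only [cubeFace, Set.mem_setOf_eq, Units.val_neg, Units.val_one, neg_mul, one_mul] at hx
      obtain ⟨hxbox, hx0⟩ := hx
      rw [mem_box] at hxbox
      refine ⟨?_, fun i hi => ?_⟩
      · have := hxbox 0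
        have h0 : (0 : ℤ) ≤ (2 * ((a - 1 : ℕ) : ℤ) + 1) * L + ((a * r₀ : ℕ) : ℤ) := by positivity
        constructor <;> linarith [this.1]
      · exact hxbox i
    · intro x hx
      simp only [cubeFace, Set.mem_setOf_eq, Units.val_neg, Units.val_one, neg_mul, one_mul] at hx
      simp; linarith [hx.2]
    · rintro y ⟨x, hx, rfl⟩
      simp only [cubeFace, Set.mem_setOf_eq, Units.val_one, one_mul] at hx
      simp [zdShiftIso_apply, hx.2]
      linarith [hlen']
    · exact hshape 0
    · simp [hardShape]
    · intro j hj
      fin_cases j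
      · exact absurd rfl hj
      · simp [hardShape]; omega
      · simp [hardShape]; omega

end Rsw3

end Summit.CriticalPhenomena.PercolationContinuityZ3.Theorems

end
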